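import Summits.AnomalousDissipation.AnomalousDissipation.Theses.MarginalStabilityChain

/-!
# Sketch — crux ideas for `MarginalStabilityChain.ChainThesis` (stmt-AnomalousDissipation-3005), ideator 3, round 1

First lemmas (signatures only, no proofs) of the two crux idea cards

* `design-shadow-injection-transfer` — `InjectionIdentity`, `ShadowBudgetTransfer`, the typed
  transfer target `NearDesignWitness` and the composition claim `NearDesignTransfer`;
* `cesaro-serrin-moment-eternal` — `CesaroSerrinEternal` (deterministic core), the typed transfer
  target `CesaroSerrinFamily` and the composition claim `CesaroSerrinTransfer`.

Everything is stated over existing declarations (`lean search --decl` run on each constant):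
`Literature.Analysis.FunctionSpaces.Torus.{IsSmooth, IsDivFree, HasZeroMean, IsClassicalNSSolutionOn, eGradNormSq}`,
`Literature.Analysis.FluidPDE.{meanEnergy, meanDissipation, longTimeAvgSup, timeMean}`,
`Literature.Analysis.FluidPDE.Torus.IsGlobalLerayHopf`, and the crux decl
`Summit.AnomalousDissipation.AnomalousDissipation.Theses.MarginalStabilityChain.ChainThesis`.
-/

namespace Summit.AnomalousDissipation.AnomalousDissipation.Cruxes.ChainThesis.SketchIdeator3

open MeasureTheory Filter Set
open scoped InnerProductSpace ENNReal
open Literature.Analysis.FunctionSpaces Literature.Analysis.FluidPDE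

/-- The flat three-torus (local notation). -/
local notation "𝕋³" => UnitAddTorus (Fin 3)
/-- Velocity values (local notation). -/
local notation "E³" => EuclideanSpace ℝ (Fin 3)

/-! ## Card `design-shadow-injection-transfer` -/

/-- **Injection identity for bounded eternal classical solutions** (first lemma of card A, provable
now, size M): for a classical solution of NS_ν with a steady smooth force on all of `ℝ × T³` whose
kinetic energy is bounded on `t ≥ 0`, the limsup-mean dissipation equals the limsup-mean injection
`⟨(f,u)⟩` — the energy identity `d/dt ½‖u‖² = (f,u) − ν‖∇u‖²` integrated over `[0,T]`, the boundary
term being `O(1/T)`. (Leray–Hopf solutions only have `≤`; this is the no-leakage clause that the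
classical class of `ChainThesis` buys for free.) -/
def InjectionIdentity : Prop :=
  ∀ (ν : ℝ) (f : 𝕋³ → E³) (u : ℝ → 𝕋³ → E³) (p : ℝ → 𝕋³ → ℝ), 0 < ν → Torus.IsSmooth f →
    Torus.IsClassicalNSSolutionOn Set.univ ν (fun _ => f) u p →
    (∃ M : ℝ, ∀ t : ℝ, 0 ≤ t → ∫ x, ‖u t x‖ ^ 2 ≤ M) →
      meanDissipation ν u = longTimeAvgSup (fun t => ∫ x, ⟪f x, u t x⟫_ℝ)

/-- **Shadow budget transfer** (card A, provable now from `InjectionIdentity`, size S–M): if an exact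
bounded eternal classical solution `u` stays within `η` in `L²(T³)` of ANY slice-smooth comparison
field `ū` ("the design") for `t ≥ 0`, then its limsup-mean dissipation is at least the design's
limsup-mean injection minus `‖f‖₂ η`, and its limsup-mean energy is at most twice the design's
pointwise energy bound plus `2η²`. The tolerance is ν-INDEPENDENT: `η ≤ ε/(2‖f‖₂)` suffices. -/
def ShadowBudgetTransfer : Prop :=
  ∀ (ν η Eb : ℝ) (f : 𝕋³ → E³) (u ū : ℝ → 𝕋³ → E³) (p : ℝ → 𝕋³ → ℝ), 0 < ν → 0 ≤ η →
    Torus.IsSmooth f → Torus.IsClassicalNSSolutionOn Set.univ ν (fun _ => f) u p →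
    (∀ t, Torus.IsSmooth (ū t)) →
    (∀ t : ℝ, 0 ≤ t → ∫ x, ‖u t x - ū t x‖ ^ 2 ≤ η ^ 2) →
    (∀ t : ℝ, 0 ≤ t → ∫ x, ‖ū t x‖ ^ 2 ≤ Eb) →
      longTimeAvgSup (fun t => ∫ x, ⟪f x, ū t x⟫_ℝ) - Real.sqrt (∫ x, ‖f x‖ ^ 2) * η
          ≤ meanDissipation ν u ∧
        meanEnergy u ≤ 2 * Eb + 2 * η ^ 2

/-- **Transfer target C⁺ of card A** (`NearDesignWitness`): ONE steady smooth force, viscosities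
`ν_j → 0`, slice-smooth DESIGNS `ū_j` with a pointwise energy bound `Eb` and limsup-mean injection
`≥ 2ε`, and EXACT eternal classical solutions `(u_j, p_j)` of NS_{ν_j}(f) that stay `η`-close to the
designs in `L²` for `t ≥ 0`, with `‖f‖₂ η ≤ ε`. Nothing ν-uniform is asked of the true orbits beyond
closeness (triage rule of crux 0448: no costume). This is the OUTPUT FORMAT of Newton–Kantorovich /
exponential-dichotomy shadowing at fixed ν. -/
def NearDesignWitness : Prop :=
  ∃ f : 𝕋³ → E³, Torus.IsSmooth f ∧ Torus.IsDivFree f ∧ Torus.HasZeroMean f ∧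
    ∃ (ν : ℕ → ℝ) (ū u : ℕ → ℝ → 𝕋³ → E³) (p : ℕ → ℝ → 𝕋³ → ℝ) (η Eb ε : ℝ),
      (∀ j, 0 < ν j) ∧ Tendsto ν atTop (nhds 0) ∧ 0 ≤ η ∧ 0 < ε ∧
      Real.sqrt (∫ x, ‖f x‖ ^ 2) * η ≤ ε ∧
      (∀ j t, Torus.IsSmooth (ū j t)) ∧
      (∀ j t, 0 ≤ t → ∫ x, ‖ū j t x‖ ^ 2 ≤ Eb) ∧
      (∀ j, 2 * ε ≤ longTimeAvgSup (fun t => ∫ x, ⟪f x, ū j t x⟫_ℝ)) ∧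
      (∀ j, Torus.IsClassicalNSSolutionOn Set.univ (ν j) (fun _ => f) (u j) (p j)) ∧
      (∀ j t, 0 ≤ t → ∫ x, ‖u j t x - ū j t x‖ ^ 2 ≤ η ^ 2)

/-- **Card A composition claim**: `NearDesignWitness → ChainThesis` (by `ShadowBudgetTransfer`, with
`E = 2 Eb + 2η²` and the same `ε`). -/
def NearDesignTransfer : Prop :=
  NearDesignWitness → Theses.MarginalStabilityChain.ChainThesis

/-! ## Card `cesaro-serrin-moment-eternal` -/

/-- **Deterministic core of card B** (`CesaroSerrinEternal`, provable modulo the torus/forced form of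
Serrin's criterion, size M–L): a two-sided trajectory `u : ℝ → (T³ → ℝ³)` which is a global
Leray–Hopf solution of NS_ν(f) from every integer time `-n` (eternity) and whose spectral enstrophy
has a finite FOURTH time-moment on every bounded interval (`‖∇u‖₂ ∈ L⁴_loc(ℝ)`, i.e. the
Prodi–Serrin class `L⁴_t H¹_x ⊂ L⁴_t L⁶_x`, `2/4 + 3/6 = 1` — exactly the integrability an isolated
Leray singular time violates, by Leray's rate `‖∇u(t)‖₂ ≳ ν^{3/4}(T* − t)^{-1/4}`) agrees a.e. in time
with an eternal CLASSICAL solution. -/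
def CesaroSerrinEternal : Prop :=
  ∀ (ν : ℝ) (f : 𝕋³ → E³) (u : ℝ → 𝕋³ → E³), 0 < ν → Torus.IsSmooth f → Torus.IsDivFree f →
    (∀ n : ℕ, Literature.Analysis.FluidPDE.Torus.IsGlobalLerayHopf ν (fun _ => f) (u (-(n : ℝ)))
      (fun t => u (t - n))) →
    (∀ n : ℕ, ∫⁻ t in Set.Ioo (-(n : ℝ)) n, Torus.eGradNormSq (u t) ^ 2 < ∞) →
      ∃ (v : ℝ → 𝕋³ → E³) (p : ℝ → 𝕋³ → ℝ),
        Torus.IsClassicalNSSolutionOn Set.univ ν (fun _ => f) v p ∧ ∀ᵐ t : ℝ, v t = u t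

/-- **Transfer target C⁺ of card B** (`CesaroSerrinFamily`): the SUMMIT's own witness family (one
steady smooth force, `ν_j → 0`, global Leray–Hopf solutions with bounded limsup-mean energy and
limsup-mean dissipation `≥ ε`) carrying, at EACH viscosity separately, a Cesàro-bounded fourth moment
of the enstrophy: `limsup_T T⁻¹∫₀ᵀ ‖∇u_j(t)‖₂⁴ dt < ∞` (a per-`j` constant, no uniformity in `j`).
Eternity is then manufactured by stationarity (Foias–Rosa–Temam trajectory statistical solutions
of the time averages of `u_j`), regularity of a.e. eternal trajectory by the moment, and ONE witness
orbit by Birkhoff + `budget_selection`. -/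
def CesaroSerrinFamily : Prop :=
  ∃ f : 𝕋³ → E³, Torus.IsSmooth f ∧ Torus.IsDivFree f ∧ Torus.HasZeroMean f ∧
    ∃ (ν : ℕ → ℝ) (u₀ : ℕ → 𝕋³ → E³) (u : ℕ → ℝ → 𝕋³ → E³),
      (∀ j, 0 < ν j) ∧ Tendsto ν atTop (nhds 0) ∧
      (∀ j, Literature.Analysis.FluidPDE.Torus.IsGlobalLerayHopf (ν j) (fun _ => f) (u₀ j) (u j)) ∧
      (∃ E : ℝ, ∀ j, meanEnergy (u j) ≤ E) ∧
      (∃ ε : ℝ, 0 < ε ∧ ∀ j, ε ≤ meanDissipation (ν j) (u j)) ∧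
      (∀ j, ∃ M : ℝ, ∀ T : ℝ, 1 ≤ T →
        timeMean (fun t => (Torus.eGradNormSq (u j t)).toReal ^ 2) T ≤ M)

/-- **Card B composition claim**: `CesaroSerrinFamily → ChainThesis` (eternity from stationarity,
regularity from the Cesàro–Serrin moment, one orbit from Birkhoff; budgets inflate to
`E* = 16‖f‖₂²E²/ε²`, `ε* = ε/2` exactly as in the proved `budget_selection` of the
`DenseLoudDesignerForces` line). -/
def CesaroSerrinTransfer : Prop :=
  CesaroSerrinFamily → Theses.MarginalStabilityChain.ChainThesis

/-- Sanity: the crux implies card B's transfer target trivially in the other direction only up to the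
moment clause; recorded as the obvious implication `ChainThesis →` (summit-type family), which is the
route's landed `closes` argument (classical ⇒ global Leray–Hopf from `u_j 0`). -/
theorem chainThesis_gives_lerayHopf_family (h : Theses.MarginalStabilityChain.ChainThesis) :
    ∃ f : 𝕋³ → E³, Torus.IsSmooth f ∧ Torus.IsDivFree f ∧ Torus.HasZeroMean f ∧
    ∃ (ν : ℕ → ℝ) (u₀ : ℕ → 𝕋³ → E³) (u : ℕ → ℝ → 𝕋³ → E³),
      (∀ j, 0 < ν j) ∧ Tendsto ν atTop (nhds 0) ∧
      (∀ j, Literature.Analysis.FluidPDE.Torus.IsGlobalLerayHopf (ν j) (fun _ => f) (u₀ j) (u j)) ∧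
      (∃ E : ℝ, ∀ j, meanEnergy (u j) ≤ E) ∧
      ∃ ε : ℝ, 0 < ε ∧ ∀ j, ε ≤ meanDissipation (ν j) (u j) := by
  obtain ⟨f, hf, hdiv, hmean, ν, u, p, hν, hν0, hsol, hE, hε⟩ := h
  exact ⟨f, hf, hdiv, hmean, ν, fun j => u j 0, u, hν, hν0, fun j => (hsol j).isGlobalLerayHopf, hE, hε⟩

end Summit.AnomalousDissipation.AnomalousDissipation.Cruxes.ChainThesis.SketchIdeator3
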